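import Literature.Computability.Cryptography.ObfuscatedGluedTrees

/-!
# Toolkit stub `toolkit_sivEnc` — SIV encryption on codes
# (crux `WbwObfuscatedGluedTrees`, stmt-QuantumAdvantage-2340; line `knowledge-of-walk-split`, stage 3, `NbrBitFP`)

Piece G1a of `NbrBitFP` (the neighbour predicate of the keyed glued-trees graph is polynomial-time ON CODES):
the deterministic authenticated encryption `sivEnc P μ k₁ k₂ x = τ ++ (x ⊕ F_{k₂}(τ))`, `τ = F_{k₁}(x)`
(`Literature/Computability/Cryptography/ObfuscatedGluedTrees.lean`, §3) is computed on the code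
`⟨1^μ, ⟨k₁, ⟨k₂, x⟩⟩⟩` by a polynomial-time string function, given only the PRF's evaluation map on codes
`hP : CodeFP (pairE unE (pairE strE strE)) strE (fun p => P.eval p.1 p.2.1 p.2.2)` (the field `FPData.prfEval`).

Proof: from `hP`, the fitted PRF `(1^μ, k, 1^m, x) ↦ prf P μ k m x` (as `FPData.prfFP`, with `FPData.fitFP`);
the tag is `prf` with `m := μ`; the bitwise xor `bxor` is `CodeFP.zipWith` of the xor bit function on the two
strings read as raw lists of bits (`strE → rawE bitE` through `strChunks` of width `1`, back through `bitsToStr`);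
the length of `x` in unary is `strLength`; assembled with `strAppend`. [folklore]
-/

set_option linter.dupNamespace false

noncomputable section

namespace Summit.QuantumAdvantage.QuantumAdvantage.Theorems.WbwObfuscatedGluedTrees.KnowledgeOfWalk.Generator

open Literature.Computability.Cryptography Literature.Computability.Complexity
open Literature.Computability.Cryptography.ObfuscatedGluedTrees Literature.Computability.QuantumComplexity
open Literature.Computability.Complexity.CodeFP (natE unE bitE pairE strE rawE)

/-! ## Strings as raw lists of bits; bitwise xor on codes -/

/-- The width-`1` chunks of a string are the singletons of its bits. [folklore] -/
private theorem sivEnc_chunks_one (s : List Bool) :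
    ((List.range s.length).map fun i => (s.drop (i * 1)).take 1) = s.map fun b => [b] := by
  apply List.ext_getElem (by simp) fun i h1 h2 => ?_
  simp only [List.length_map, List.length_range] at h1
  simp only [List.getElem_map, List.getElem_range, Nat.mul_one]
  rw [List.drop_eq_getElem_cons h1, List.take_succ_cons, List.take_zero]

/-- A string as the raw list of its bits (the change of code `strE → rawE bitE`). [folklore] -/
private theorem sivEnc_explode : CodeFP strE (rawE bitE) (fun s : List Bool => s) := by
  obtain ⟨C, hC, h⟩ :=
    CodeFP.strChunks.comp (CodeFP.strLength.pair ((CodeFP.const strE 1).pair (CodeFP.id strE)))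
  refine ⟨C, hC, fun s => ?_⟩
  rw [h]
  show rawE strE ((List.range s.length).map fun i => (s.drop (i * 1)).take 1) = rawE bitE s
  rw [sivEnc_chunks_one]
  unfold rawE
  rw [List.map_map]
  rfl

/-- **Bitwise xor of two strings on codes** (`bxor`, truncated to the shorter string). [folklore] -/
private theorem sivEnc_bxorFP :
    CodeFP (pairE strE strE) strE (fun p : List Bool × List Bool => bxor p.1 p.2) := by
  have hz : CodeFP (pairE strE strE) (rawE bitE)
      (fun p : List Bool × List Bool => List.zipWith (fun a b => xor a b) p.1 p.2) :=
    ((CodeFP.zipWith (σ := List Bool × List Bool) (eσ := pairE strE strE) (g := fun t => (t.2.1 ^^ t.2.2))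
      (CodeFP.xor (CodeFP.snd _ _).fst' (CodeFP.snd _ _).snd')).comp
      ((CodeFP.id _).pair ((sivEnc_explode.comp (CodeFP.fst _ _)).pair
        (sivEnc_explode.comp (CodeFP.snd _ _))))).congr fun _ => rfl
  exact (CodeFP.bitsToStr.comp hz).congr fun _ => rfl

/-! ## The fitted PRF on codes -/

/-- `(1^μ, k, 1^m, x) ↦ prf P μ k m x` from the PRF's evaluation map on codes (the proof of `FPData.prfFP` with
the hypothesis in place of the record field). [folklore] -/
private theorem sivEnc_prfFP (P : PuncturablePRFScheme)
    (hP : CodeFP (pairE unE (pairE strE strE)) strE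
      (fun p : ℕ × List Bool × List Bool => P.eval p.1 p.2.1 p.2.2)) :
    CodeFP (pairE unE (pairE strE (pairE unE strE))) strE
      (fun p : ℕ × List Bool × ℕ × List Bool => prf P p.1 p.2.1 p.2.2.1 p.2.2.2) := by
  have pμ : CodeFP (pairE unE (pairE strE (pairE unE strE))) unE
      (fun p : ℕ × List Bool × ℕ × List Bool => p.1) := CodeFP.fst _ _
  have pk : CodeFP (pairE unE (pairE strE (pairE unE strE))) strE
      (fun p : ℕ × List Bool × ℕ × List Bool => p.2.1) := (CodeFP.snd _ _).fst'
  have pm : CodeFP (pairE unE (pairE strE (pairE unE strE))) unE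
      (fun p : ℕ × List Bool × ℕ × List Bool => p.2.2.1) := (CodeFP.snd _ _).snd'.fst'
  have px : CodeFP (pairE unE (pairE strE (pairE unE strE))) strE
      (fun p : ℕ × List Bool × ℕ × List Bool => p.2.2.2) := (CodeFP.snd _ _).snd'.snd'
  have hin : CodeFP (pairE unE (pairE strE (pairE unE strE))) strE
      (fun p : ℕ × List Bool × ℕ × List Bool => fit p.1 p.2.2.2) :=
    FPData.fitFP.comp (pμ.pair px)
  have hev : CodeFP (pairE unE (pairE strE (pairE unE strE))) strE
      (fun p : ℕ × List Bool × ℕ × List Bool => P.eval p.1 p.2.1 (fit p.1 p.2.2.2)) :=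
    hP.comp (pμ.pair (pk.pair hin))
  exact (FPData.fitFP.comp (pm.pair hev)).congr fun _ => rfl

/-! ## The stub -/

/-- **TOOLKIT G1a — SIV encryption on codes**: `(1^μ, k₁, k₂, x) ↦ sivEnc P μ k₁ k₂ x`
(`= τ ++ (x ⊕ prf P μ k₂ |x| τ)`, `τ = tag P μ k₁ x = prf P μ k₁ μ x`) is computed on codes by a
polynomial-time string function, from the PRF's evaluation map on codes. [folklore] -/
theorem toolkit_sivEnc :
    ∀ (P : PuncturablePRFScheme),
      Literature.Computability.Complexity.CodeFP (pairE unE (pairE strE strE)) strE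
        (fun p : ℕ × List Bool × List Bool => P.eval p.1 p.2.1 p.2.2) →
      Literature.Computability.Complexity.CodeFP (pairE unE (pairE strE (pairE strE strE))) strE
        (fun t : ℕ × List Bool × List Bool × List Bool => sivEnc P t.1 t.2.1 t.2.2.1 t.2.2.2) := by
  intro P hP
  have hprf := sivEnc_prfFP P hP
  -- the four projections of `t = (μ, k₁, k₂, x)`
  have pμ : CodeFP (pairE unE (pairE strE (pairE strE strE))) unE
      (fun t : ℕ × List Bool × List Bool × List Bool => t.1) := CodeFP.fst _ _
  have pk₁ : CodeFP (pairE unE (pairE strE (pairE strE strE))) strE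
      (fun t : ℕ × List Bool × List Bool × List Bool => t.2.1) := (CodeFP.snd _ _).fst'
  have pk₂ : CodeFP (pairE unE (pairE strE (pairE strE strE))) strE
      (fun t : ℕ × List Bool × List Bool × List Bool => t.2.2.1) := (CodeFP.snd _ _).snd'.fst'
  have px : CodeFP (pairE unE (pairE strE (pairE strE strE))) strE
      (fun t : ℕ × List Bool × List Bool × List Bool => t.2.2.2) := (CodeFP.snd _ _).snd'.snd'
  -- the tag `τ = prf P μ k₁ μ x`
  have htag : CodeFP (pairE unE (pairE strE (pairE strE strE))) strE
      (fun t : ℕ × List Bool × List Bool × List Bool => tag P t.1 t.2.1 t.2.2.2) :=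
    (hprf.comp (pμ.pair (pk₁.pair (pμ.pair px)))).congr fun _ => rfl
  -- the length of the plaintext, in unary
  have hlen : CodeFP (pairE unE (pairE strE (pairE strE strE))) unE
      (fun t : ℕ × List Bool × List Bool × List Bool => t.2.2.2.length) :=
    CodeFP.strLength.comp px
  -- the mask `prf P μ k₂ |x| τ`
  have hmask : CodeFP (pairE unE (pairE strE (pairE strE strE))) strE
      (fun t : ℕ × List Bool × List Bool × List Bool =>
        prf P t.1 t.2.2.1 t.2.2.2.length (tag P t.1 t.2.1 t.2.2.2)) :=
    hprf.comp (pμ.pair (pk₂.pair (hlen.pair htag)))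
  -- the masked body `x ⊕ mask`
  have hbody : CodeFP (pairE unE (pairE strE (pairE strE strE))) strE
      (fun t : ℕ × List Bool × List Bool × List Bool =>
        bxor t.2.2.2 (prf P t.1 t.2.2.1 t.2.2.2.length (tag P t.1 t.2.1 t.2.2.2))) :=
    sivEnc_bxorFP.comp (px.pair hmask)
  exact (CodeFP.strAppend.comp (htag.pair hbody)).congr fun _ => rfl

end Summit.QuantumAdvantage.QuantumAdvantage.Theorems.WbwObfuscatedGluedTrees.KnowledgeOfWalk.Generator

end
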